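import Summits.RiemannHypothesis.RiemannHypothesis.Theorems.WeilTwoPrimeDeflM80FDef
import Summits.RiemannHypothesis.RiemannHypothesis.Theorems.WeilTwoPrimeDeflM80FDataPO29
import Literature.NumberTheory.LFunctions.WeilBlockRowsR
import HarnessLib

/-!
# Deflated two-prime certificate M80F: the materialized odd block agrees with `P_r + Σ μ ĉ ĉᵀ`, rows 130–135

`WeilCert.checkPmRowG` for certificate M80F (odd block), by `decide +kernel`. Pure proof file; nothing is asserted.
-/

set_option linter.dupNamespace false

noncomputable section

namespace Summit.RiemannHypothesis.RiemannHypothesis.Theorems.EvenWinsBeyondArch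

open Literature.NumberTheory.LFunctions

set_option maxHeartbeats 0 in
/-- Row 130 of the materialized odd block is row 130 of `P_r + Σ μ ĉ ĉᵀ` (certificate M80F). [folklore] -/
theorem checkPmRowG1_130_weilCertDeflM80F : weilCertDeflM80FBase.checkPmRowG weilCertDeflM80FP weilCertDeflM80FPmO 1 130 = true := by
  decide +kernel

set_option maxHeartbeats 0 in
/-- Row 131 of the materialized odd block is row 131 of `P_r + Σ μ ĉ ĉᵀ` (certificate M80F). [folklore] -/
theorem checkPmRowG1_131_weilCertDeflM80F : weilCertDeflM80FBase.checkPmRowG weilCertDeflM80FP weilCertDeflM80FPmO 1 131 = true := by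
  decide +kernel

set_option maxHeartbeats 0 in
/-- Row 132 of the materialized odd block is row 132 of `P_r + Σ μ ĉ ĉᵀ` (certificate M80F). [folklore] -/
theorem checkPmRowG1_132_weilCertDeflM80F : weilCertDeflM80FBase.checkPmRowG weilCertDeflM80FP weilCertDeflM80FPmO 1 132 = true := by
  decide +kernel

set_option maxHeartbeats 0 in
/-- Row 133 of the materialized odd block is row 133 of `P_r + Σ μ ĉ ĉᵀ` (certificate M80F). [folklore] -/
theorem checkPmRowG1_133_weilCertDeflM80F : weilCertDeflM80FBase.checkPmRowG weilCertDeflM80FP weilCertDeflM80FPmO 1 133 = true := by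
  decide +kernel

set_option maxHeartbeats 0 in
/-- Row 134 of the materialized odd block is row 134 of `P_r + Σ μ ĉ ĉᵀ` (certificate M80F). [folklore] -/
theorem checkPmRowG1_134_weilCertDeflM80F : weilCertDeflM80FBase.checkPmRowG weilCertDeflM80FP weilCertDeflM80FPmO 1 134 = true := by
  decide +kernel

set_option maxHeartbeats 0 in
/-- Row 135 of the materialized odd block is row 135 of `P_r + Σ μ ĉ ĉᵀ` (certificate M80F). [folklore] -/
theorem checkPmRowG1_135_weilCertDeflM80F : weilCertDeflM80FBase.checkPmRowG weilCertDeflM80FP weilCertDeflM80FPmO 1 135 = true := by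
  decide +kernel


end Summit.RiemannHypothesis.RiemannHypothesis.Theorems.EvenWinsBeyondArch
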